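/-
Copyright (c) 2026 the pub-hodgecm-mathlib formalisation cell (harness21).  Prover seat hodgecm-mathlib-F0P2-p08 (g0) (L1; S2 (law) sequel for desk K2Liu-p05 (g6)'s final assembly
`K2LiuArchSWSpanningStd` step 6 `?law` at `χ′ := χ ^ M₂`): Track B «K2-LIT», hLiu418 = stmt-HodgeConjecture-24832, road `K2_Liu`, socket #42S, organ S2.
-/
import Literature.NumberTheory.Automorphic.UnitaryGroupAdelicCharactersArchTypeTwist   -- ★ `HeckeCharacter.HasUnitaryArchType.mul_zero_right`
import HarnessLib

/-!
# Crux `HLiu418`, #42S organ S2, letter: the unitary archimedean type of a POWER of a Hecke character — `χ` of type `(e, 0)` ⇒ `χ^m` of type `(m·e, 0)`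

Cell `hodgecm-mathlib`, crux item hLiu418 = `stmt-HodgeConjecture-24832`; squad K2 ∕ K2Liu (L1, LEAD F0P6-plan (g14)); prover F0P2-p08 (g0).  THEOREMS ONLY (no `def`, no instance,
no notation, no named-fact hypothesis, no `sorry`); lane `--supports stmt-HodgeConjecture-24832 --as helper`.

The S2 (law) dictionary ★ `K2LiuArchSiegelCharacterTube.siegelDeltaCharacter_archPlace` ∕ ★ `K2LiuArchSiegelCharacterTubeConsumer.apply_update_tube_mul` is consumed at the Hecke
character `χ′ := χ ^ M₂` of ★ `isArchSiegelDeltaSection_archSWValue` (weight `(χ^{M₂}, (M₂ − n)∕2)`) and wants `ht : χ′.HasUnitaryArchType t′ 0`; from `χ.HasUnitaryArchType t 0` this file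
supplies `t′ = M₂ · t` (so the (law) weight is `k_w = −M₂ t_w`, K2Liu-ref1's PIN).
* `hasUnitaryArchType_one` — the trivial character has type `(0, 0)`;
* **`HasUnitaryArchType.pow_zero_right`** — `χ` of type `(e, 0)` ⇒ `χ ^ m` of type `(w ↦ m · e w, 0)` (induction on ★ `HasUnitaryArchType.mul_zero_right`).
[Patrikis2019, §2.1 (archimedean parameters multiply under products of characters)].
HONEST LABEL.  Count-neutral helper: `HC_CM` is proved only modulo the 7 printed citations (2 remaining named inputs: hLiu418 = `stmt-HodgeConjecture-24832`,
h413 = `stmt-HodgeConjecture-24833`) until rung 0 closes; this file closes no socket.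
-/

set_option autoImplicit false
set_option linter.dupNamespace false -- the mandated namespace repeats `HodgeConjecture.HodgeConjecture`

noncomputable section

open NumberField NumberField.InfinitePlace
open Literature.NumberTheory.GaloisRepresentations

namespace Summit.HodgeConjecture.HodgeConjecture.Cruxes.HLiu418.K2LiuHeckeCharacterArchTypePow

variable {L : Type} [Field L] [NumberField L]

/-- **the trivial Hecke character has unitary archimedean type `(0, 0)`** (`(z∕‖z‖)^0 · ‖z‖^{0·i} = 1`). [cite: Patrikis2019, §2.1] -/
theorem hasUnitaryArchType_one : (1 : HeckeCharacter L).HasUnitaryArchType (fun _ => 0) 0 := by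
  intro x
  rw [HeckeCharacter.one_apply, Units.val_one]
  refine (Finset.prod_eq_one fun w _ => ?_).symm
  show archUnitaryValue 0 0 _ = 1
  unfold archUnitaryValue
  rw [zpow_zero, Complex.ofReal_zero, zero_mul, Complex.cpow_zero, mul_one]

/-- **THE TYPE OF A POWER**: if `χ` has unitary archimedean type `(e, 0)` then `χ ^ m` has type `(w ↦ m · e w, 0)`. [cite: Patrikis2019, §2.1] -/
theorem _root_.Literature.NumberTheory.GaloisRepresentations.HeckeCharacter.HasUnitaryArchType.pow_zero_right [IsCMField L]
    {χ : HeckeCharacter L} {e : InfinitePlace L → ℤ} (hχ : χ.HasUnitaryArchType e 0) (m : ℕ) :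
    (χ ^ m).HasUnitaryArchType (fun w => (m : ℤ) * e w) 0 := by
  induction m with
  | zero =>
    have h : (fun w : InfinitePlace L => ((0 : ℕ) : ℤ) * e w) = fun _ => 0 := funext fun _ => by rw [Nat.cast_zero, zero_mul]
    rw [pow_zero, h]
    exact hasUnitaryArchType_one
  | succ m ih =>
    have h : (fun w : InfinitePlace L => ((m + 1 : ℕ) : ℤ) * e w) = fun w => (m : ℤ) * e w + e w := funext fun _ => by push_cast; ring
    rw [pow_succ, h]
    exact ih.mul_zero_right L hχ

/-- the same with the multiplier written `m • e`. [cite: Patrikis2019, §2.1] -/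
theorem _root_.Literature.NumberTheory.GaloisRepresentations.HeckeCharacter.HasUnitaryArchType.pow_zero_right' [IsCMField L]
    {χ : HeckeCharacter L} {e : InfinitePlace L → ℤ} (hχ : χ.HasUnitaryArchType e 0) (m : ℕ) :
    (χ ^ m).HasUnitaryArchType (m • e) 0 := by
  have h : (m • e : InfinitePlace L → ℤ) = fun w => (m : ℤ) * e w := funext fun w => by simp [Pi.smul_apply]
  rw [h]
  exact hχ.pow_zero_right m

end Summit.HodgeConjecture.HodgeConjecture.Cruxes.HLiu418.K2LiuHeckeCharacterArchTypePow

end
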